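import Mathlib
import Summits.Schanuel.Schanuel.Theses.RigidCore
import Summits.Schanuel.Schanuel.Theorems.RigidCoreMinimalCounterexampleInAclNoFullLineSlice
import Summits.Schanuel.Schanuel.Theorems.RigidCoreMinimalCounterexampleInAclNoFullLineBranch
import Summits.Schanuel.Schanuel.Theorems.RigidCoreMinimalCounterexampleInAclCosetBranchCover
import Literature.NumberTheory.Transcendental.TrdegZariskiDim

/-!
# NO FULL LINE OF MATES IN CORANK ONE — crux stmt-Schanuel-0969 `RigidCore.MinimalCounterexampleInAcl`

Line `kernel-arithmetic-selection` (lead prover-line-stmt-Schanuel-0969-c12-0), registered stub `stub_corankOne_noFullLine`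
(`--supports stmt-Schanuel-0969`): the analytic half of ARITHMETIC ISOLATION on the corank-one sector of item 14744.

Let `x` be a first failure of Schanuel of rank `m + 1 ≥ 3` in corank-one normal form (`e^{x_k} ∈ ℚ̄` for `k < m`, pure in the
last direction) and `μ ∈ ℤ^m`, `μ ≠ 0`.  Then NOT every kernel translate `(x_k + 2πijμ_k)_{k<m}`, `j ∈ ℤ`, is the `u`-part of
a mate of `x`.  Proof:

1. SLICE (Theorems/…NoFullLineSlice).  Pick `μ_{k₀} = d ≠ 0`.  Along the line only `v = x_{k₀}` moves (`v_j = v + 2πijd`); the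
   integer coordinates `e_i = d x_i − μ_i x_{k₀}` (`i < m`) are CONSTANT.  Over `K = ℚ(e)` the point `P = (v, w, e^v, e^w)`
   (`w = x_m`) has transcendence degree `≤ 1` (`u = (x_k)_{k<m}` is algebraically independent by `SchanuelRank m`, so `w, e^w` are
   algebraic over `ℚ(u) ⊆ K(v)`), so its `K`-locus `W ⊆ ℂ² × ℂ²` is a Zariski closed set of dimension `< 2`, and by transfer of
   the ℚ-relations of `(x, eˣ)` to mates every slice point `q_j = (v_j, w_j)` of a mate on the line is an independent exponential
   point of `W` on the coset `v + 2πiℤ`.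
2. FIBRES.  The family `Q = {q_j}` meets every fibre `{eˣ = ω}` finitely: mates with the same exponentials form a kernel class,
   finite at every rank (`branch_finite_voc`, Theorems/…LogSector).
3. BRANCHES AND WINDOWS.  By the landed coset branch cover (`stub_cosetBranchCover`) all but finitely many `q_j`, `j ≥ J₀`, lie on
   finitely many branches at infinity of `W`; on each branch long windows of `Q`-hits recur at finitely many positions
   (`branch_window_finite_of_fibre`, Theorems/…NoFullLineBranch, from the landed coset window rigidity).  But a full line puts,
   by two pigeonholes (a popular branch in each block of `N` consecutive `j`, then a popular (branch, pattern) pair among the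
   blocks), one fixed long window at infinitely many positions on one branch — contradiction.

The hypotheses `2 ≤ m` and purity of the last direction are not used: the argument works at every first failure whose first `m`
exponentials are algebraic (on the log sector it is a special case of `locusMates_finite`).  The degenerate case of the brief's
route (polynomial phase, field of definition, kernel-translation rigidity) does not arise separately: a polynomial phase makes
`e^{x₁}` constant along the branch (`eventually_const_of_isAlgebraic_exp`), which is excluded by step 2 directly.

References: card `Cruxes/MinimalCounterexampleInAcl/Ideas/arithmetic-isolation.md`; status note
`Cruxes/MinimalCounterexampleInAcl/Lines/kernel_arithmetic_selection.md` §Addendum c12.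
-/

noncomputable section

set_option linter.dupNamespace false

open Complex Filter Topology Set Metric MvPolynomial

namespace Summit.Schanuel.Schanuel.Cruxes.MinimalCounterexampleInAcl.KernelArithmeticSelection

open Literature.NumberTheory.Transcendental

/-- The branch point `((t⁻ᵉ, Φ₁ t / tᴺ), (Φ₂ t / tᴺ, Φ₃ t / tᴺ)) ∈ ℂ² × ℂ²` (local notation). -/
local notation3 "𝔟[" e ", " N ", " Φ₁ ", " Φ₂ ", " Φ₃ ", " t "]" =>
  (Sum.elim ![((t : ℂ) ^ (e : ℕ))⁻¹, (Φ₁ : ℂ → ℂ) t / t ^ (N : ℕ)]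
    ![(Φ₂ : ℂ → ℂ) t / t ^ (N : ℕ), (Φ₃ : ℂ → ℂ) t / t ^ (N : ℕ)] : Fin 2 ⊕ Fin 2 → ℂ)

variable {n m : ℕ}

/-! ## Kernel classes of mates are finite; the corank-one transcendence count -/

/-- **Mates with prescribed exponentials are finitely many** (every rank): they form one kernel class `x₀ + 2πiℤⁿ` of mates of the
mate `x₀`, a first failure with the same locus (`mate_firstFailure_voc`), and kernel classes of mates of a first failure are finite
(`branch_finite_voc`). [folklore] -/
theorem locusMates_cexp_fibre_finite {x : Fin n → ℂ} (hx : x ∈ firstFailures n) (y : Fin n → ℂ) :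
    Set.Finite {x' : Fin n → ℂ | x' ∈ locusMates x ∧ cexp ∘ x' = y} := by
  by_cases hne : Set.Nonempty {x' : Fin n → ℂ | x' ∈ locusMates x ∧ cexp ∘ x' = y}
  · obtain ⟨x₀, hx₀M, hx₀y⟩ := hne
    obtain ⟨hff₀, hlocus₀⟩ := mate_firstFailure_voc hx hx₀M
    have hMeq : locusMates x₀ = locusMates x := by
      unfold locusMates; rw [hlocus₀]
    refine ((branch_finite_voc hff₀).image (kerTranslate x₀)).subset ?_
    rintro x' ⟨hx'M, hx'y⟩
    obtain ⟨k, rfl⟩ := exists_kerTranslate_of_cexp_eq (x₀ := x₀) (x' := x') (by rw [hx'y, hx₀y])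
    refine ⟨k, ?_, rfl⟩
    show kerTranslate x₀ k ∈ locusMates x₀
    rw [hMeq]; exact hx'M
  · rw [Set.not_nonempty_iff_eq_empty] at hne
    rw [hne]; exact Set.finite_empty

/-- **In corank-one normal form the logarithmic block is algebraically independent**: at a first failure `x` of rank `m + 1` with
`e^{x_k} ∈ ℚ̄` for `k < m`, the tuple `u = (x_k)_{k<m}` is algebraically independent over `ℚ` (`SchanuelRank m` at the ℚ-linearly
independent `u` gives `trdeg ℚ(u, eᵘ) ≥ m`, and `eᵘ` is algebraic). [cite: Kirby2010, §1] -/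
theorem algebraicIndependent_castSucc {x : Fin (m + 1) → ℂ} (hx : x ∈ firstFailures (m + 1))
    (halg : ∀ i : Fin (m + 1), (i : ℕ) < m → IsAlgebraic ℚ (cexp (x i))) :
    AlgebraicIndependent ℚ (fun k : Fin m => x (Fin.castSucc k)) := by
  classical
  set u : Fin m → ℂ := fun k => x (Fin.castSucc k) with hu
  have hli : LinearIndependent ℚ u := hx.1.comp _ (Fin.castSucc_injective m)
  have hm : (m : Cardinal) ≤ Algebra.trdeg ℚ ↥(IntermediateField.adjoin ℚ (range u ∪ range (cexp ∘ u))) :=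
    hx.2.2 m (lt_add_one m) u hli
  obtain ⟨S, hS, hSalg⟩ := exists_finset_algebraicIndependent_maximal u
  set Pt : Fin m ⊕ Fin m → ℂ := Sum.elim u (cexp ∘ u) with hPt
  have hsub : Algebra.adjoin ℚ (Set.range fun i : S => u i) ≤
      Algebra.adjoin ℚ (Set.range fun i : (S.map Function.Embedding.inl : Finset (Fin m ⊕ Fin m)) => Pt i) := by
    refine Algebra.adjoin_mono ?_
    rintro _ ⟨⟨i, hi⟩, rfl⟩
    exact ⟨⟨Sum.inl i, Finset.mem_map_of_mem _ hi⟩, rfl⟩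
  have hcard := trdeg_adjoin_le_card Pt (S.map Function.Embedding.inl) (by
    rintro (j | j)
    · exact (hSalg j).tower_top_of_subalgebra_le hsub
    · have hj : IsAlgebraic ℚ (Pt (Sum.inr j)) := halg (Fin.castSucc j) (by simp)
      exact hj.extendScalars (algebraMap ℚ _).injective)
  rw [hPt, Set.Sum.elim_range, Finset.card_map] at hcard
  have hmS : m ≤ S.card := by exact_mod_cast hm.trans hcard
  have hSu : S = Finset.univ := Finset.eq_univ_of_card S (by
    have := S.card_le_univ; rw [Fintype.card_fin] at this ⊢; omega)
  subst hSu
  exact hS.comp (fun i : Fin m => (⟨i, Finset.mem_univ i⟩ : (Finset.univ : Finset (Fin m))))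
    fun a b h => by simpa using h

/-- **Every element of `ℚ(x, eˣ)` is algebraic over `ℚ[u]`** in corank-one normal form (a transcendental one would give `m + 1`
independent elements of a field of transcendence degree `< m + 1`). [cite: Kirby2010, §1] -/
theorem isAlgebraic_adjoin_castSucc {x : Fin (m + 1) → ℂ} (hx : x ∈ firstFailures (m + 1))
    (halg : ∀ i : Fin (m + 1), (i : ℕ) < m → IsAlgebraic ℚ (cexp (x i))) {z : ℂ}
    (hz : z ∈ IntermediateField.adjoin ℚ (range x ∪ range (cexp ∘ x))) :
    IsAlgebraic (Algebra.adjoin ℚ (Set.range fun k : Fin m => x (Fin.castSucc k))) z := by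
  set L : IntermediateField ℚ ℂ := IntermediateField.adjoin ℚ (range x ∪ range (cexp ∘ x)) with hL
  by_contra htr
  have hu := algebraicIndependent_castSucc hx halg
  have hind : AlgebraicIndependent ℚ (fun o : Option (Fin m) => o.elim z fun k : Fin m => x (Fin.castSucc k)) :=
    (hu.option_iff_transcendental z).2 htr
  have hmem : ∀ o : Option (Fin m), (o.elim z (fun k : Fin m => x (Fin.castSucc k)) : ℂ) ∈ L := by
    rintro (_ | k)
    · exact hz
    · exact IntermediateField.subset_adjoin ℚ _ (Or.inl ⟨Fin.castSucc k, rfl⟩)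
  let v : Option (Fin m) → L := fun o => ⟨_, hmem o⟩
  have hv : AlgebraicIndependent ℚ v := AlgebraicIndependent.of_comp L.val hind
  have hle := hv.cardinalMk_le_trdeg
  simp only [Cardinal.mk_fintype, Fintype.card_option, Fintype.card_fin] at hle
  have h1 : ((m + 1 : ℕ) : Cardinal) ≤ Algebra.trdeg ℚ L := by exact_mod_cast hle
  have h2 : Algebra.trdeg ℚ L < ((m + 1 : ℕ) : Cardinal) := by exact_mod_cast hx.2.1
  exact (not_le.2 h2) h1

/-! ## The registered stub -/

/-- **Stub S9 — CORANK ONE: NO FULL LINE OF MATES (PROVED).**  For a normal-form first failure `x` of rank `m + 1 ≥ 3` and mixed rank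
`m`, no non-zero integer direction `μ ∈ ℤ^m` has ALL kernel translates `(x_k + 2πijμ_k)_{k<m}`, `j ∈ ℤ`, realised as `u`-parts of
mates (slice over the field of constants of the line + coset branch cover + coset window rigidity + finiteness of kernel classes;
see the module docstring). [folklore] -/
theorem stub_corankOne_noFullLine : ∀ (m : ℕ), 2 ≤ m → ∀ (x : Fin (m + 1) → ℂ), x ∈ Summit.Schanuel.Schanuel.Cruxes.MinimalCounterexampleInAcl.KernelArithmeticSelection.firstFailures (m + 1) → (∀ i : Fin (m + 1), (i : ℕ) < m → IsAlgebraic ℚ (Complex.exp (x i))) → (∀ M : Fin (m + 1) → ℤ, M (Fin.last m) ≠ 0 → Transcendental ℚ (Complex.exp (∑ i, (M i : ℂ) * x i))) → ∀ μ : Fin m → ℤ, μ ≠ 0 → ∃ j : ℤ, (fun k => x (Fin.castSucc k) + 2 * ↑Real.pi * Complex.I * ((j • μ : Fin m → ℤ) k : ℂ)) ∉ {v : Fin m → ℂ | ∃ x' ∈ Summit.Schanuel.Schanuel.Cruxes.MinimalCounterexampleInAcl.KernelArithmeticSelection.locusMates x, ∀ k, v k = x' (Fin.castSucc k)} := by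
  intro m hm x hx halg hpure μ hμ
  classical
  by_contra hall
  push Not at hall
  simp only [Set.mem_setOf_eq] at hall
  choose xm hxm hxmeq using hall
  obtain ⟨k₀, hk₀⟩ : ∃ k₀, μ k₀ ≠ 0 := Function.ne_iff.1 hμ
  set d : ℤ := μ k₀ with hd
  have hd0 : (d : ℂ) ≠ 0 := by exact_mod_cast hk₀
  have h2πi : (2 * ↑Real.pi * I : ℂ) ≠ 0 := by simp [Real.pi_ne_zero, I_ne_zero]
  -- ### the slice frame
  set v : ℂ := x (Fin.castSucc k₀) with hv
  set evOf : (Fin (m + 1) → ℂ) → Fin m → ℂ := fun y i => (d : ℂ) * y (Fin.castSucc i) - (μ i : ℂ) * y (Fin.castSucc k₀)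
    with hevOf
  set ev : Fin m → ℂ := evOf x with hev
  set π : (Fin (m + 1) → ℂ) → Fin 2 → ℂ := fun y => ![y (Fin.castSucc k₀), y (Fin.last m)] with hπ
  set P : Fin 2 ⊕ Fin 2 → ℂ := Sum.elim (π x) (cexp ∘ π x) with hP
  -- coordinates of the mates on the line
  have hxmc : ∀ (j : ℤ) (k : Fin m), xm j (Fin.castSucc k) = x (Fin.castSucc k) + 2 * ↑Real.pi * I * ((j : ℂ) * (μ k : ℂ)) := by
    intro j k
    rw [← hxmeq j k, Pi.smul_apply, smul_eq_mul]; push_cast; rfl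
  have hevm : ∀ j : ℤ, evOf (xm j) = ev := by
    intro j; funext i
    simp only [hev, hevOf, hxmc]; ring
  set q : ℤ → Fin 2 → ℂ := fun j => π (xm j) with hq
  have hq0 : ∀ j : ℤ, q j 0 = v + 2 * ↑Real.pi * I * ((j * d : ℤ) : ℂ) := by
    intro j
    simp only [hq, hπ, Matrix.cons_val_zero, hxmc, hv]; push_cast; ring
  have hq1 : ∀ j : ℤ, q j 1 = xm j (Fin.last m) := fun j => by simp [hq, hπ]
  have hqinj : Function.Injective q := by
    intro j j' hjj
    have h := congrFun hjj 0
    rw [hq0, hq0, add_right_inj] at h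
    have h' : ((j * d : ℤ) : ℂ) = ((j' * d : ℤ) : ℂ) := mul_left_cancel₀ h2πi h
    have h'' : j * d = j' * d := by exact_mod_cast h'
    exact mul_right_cancel₀ hk₀ h''
  have hxminj : Function.Injective xm := fun j j' h => hqinj (by simp only [hq, h])
  -- ### (1) the slice curve over the field of constants `ℚ(e)`: closed, of dimension `< 2`
  obtain ⟨W, hWcl, hWdim, hWmem⟩ : ∃ W : Set (Fin 2 ⊕ Fin 2 → ℂ), IsZariskiClosed ℂ W ∧ zariskiDim ℂ W < 2 ∧
      ∀ P' : Fin 2 ⊕ Fin 2 → ℂ, (∀ H : MvPolynomial (Fin m ⊕ (Fin 2 ⊕ Fin 2)) ℚ,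
        MvPolynomial.aeval (Sum.elim ev P) H = 0 → MvPolynomial.aeval (Sum.elim ev P') H = 0) → P' ∈ W := by
    set Lx : IntermediateField ℚ ℂ := IntermediateField.adjoin ℚ (range x ∪ range (cexp ∘ x)) with hLx
    -- every element of `ℚ(x, eˣ)` is algebraic over `ℚ[e, v]`
    have hT : ∀ z ∈ Lx, IsAlgebraic (Algebra.adjoin ℚ (Set.range ev ∪ {v})) z := by
      intro z hz
      refine (isAlgebraic_adjoin_castSucc hx halg hz).adjoin_of_forall_isAlgebraic fun y hy => ?_
      obtain ⟨⟨k, rfl⟩, -⟩ := hy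
      refine isAlgebraic_algebraMap (A := ℂ) (⟨x (Fin.castSucc k), ?_⟩ : Algebra.adjoin ℚ (Set.range ev ∪ {v}))
      have hk : x (Fin.castSucc k) = ((d : ℚ)⁻¹ : ℚ) • (ev k + ((μ k : ℚ) : ℚ) • v) := by
        simp only [hev, hevOf, hv]
        rw [Rat.smul_def, Rat.smul_def]; push_cast
        field_simp; ring
      rw [hk]
      have h1 : ev k ∈ Algebra.adjoin ℚ (Set.range ev ∪ {v}) := Algebra.subset_adjoin (Or.inl ⟨k, rfl⟩)
      have h2 : v ∈ Algebra.adjoin ℚ (Set.range ev ∪ {v}) := Algebra.subset_adjoin (Or.inr rfl)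
      exact (Algebra.adjoin ℚ (Set.range ev ∪ {v})).smul_mem
        ((Algebra.adjoin ℚ (Set.range ev ∪ {v})).add_mem h1 ((Algebra.adjoin ℚ (Set.range ev ∪ {v})).smul_mem h2 _)) _
    have hLv : v ∈ Lx := IntermediateField.subset_adjoin ℚ _ (Or.inl ⟨_, rfl⟩)
    have hLw : x (Fin.last m) ∈ Lx := IntermediateField.subset_adjoin ℚ _ (Or.inl ⟨_, rfl⟩)
    have hLev : cexp v ∈ Lx := IntermediateField.subset_adjoin ℚ _ (Or.inr ⟨Fin.castSucc k₀, rfl⟩)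
    have hLew : cexp (x (Fin.last m)) ∈ Lx := IntermediateField.subset_adjoin ℚ _ (Or.inr ⟨_, rfl⟩)
    refine exists_sliceCurve ev P v fun i => hT _ ?_
    rcases i with i | i <;> fin_cases i
    · exact hLv
    · exact hLw
    · exact hLev
    · exact hLew
  -- ### the slice points of the mates are independent exponential points of `W`
  set Q : Set (Fin 2 → ℂ) := Set.range q with hQ
  have hQW : Q ⊆ indepExpPoints W := by
    rintro _ ⟨j, rfl⟩
    refine ⟨?_, ?_⟩
    · have e2 : q j = xm j ∘ ![Fin.castSucc k₀, Fin.last m] := by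
        funext i; fin_cases i <;> simp [hq, hπ]
      rw [e2]
      refine (hxm j).1.comp _ fun a b hab => ?_
      fin_cases a <;> fin_cases b
      · rfl
      · exact absurd hab (Fin.castSucc_lt_last k₀).ne
      · exact absurd hab (Fin.castSucc_lt_last k₀).ne'
      · rfl
    · -- transfer of the ℚ-relations of `(x, eˣ)` through the integer substitution
      set s : Fin m ⊕ (Fin 2 ⊕ Fin 2) → MvPolynomial (Fin (m + 1) ⊕ Fin (m + 1)) ℚ :=
        Sum.elim (fun i => C (d : ℚ) * X (Sum.inl (Fin.castSucc i)) - C (μ i : ℚ) * X (Sum.inl (Fin.castSucc k₀)))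
          (Sum.elim ![X (Sum.inl (Fin.castSucc k₀)), X (Sum.inl (Fin.last m))]
            ![X (Sum.inr (Fin.castSucc k₀)), X (Sum.inr (Fin.last m))]) with hs
      have key : ∀ (y : Fin (m + 1) → ℂ) (H : MvPolynomial (Fin m ⊕ (Fin 2 ⊕ Fin 2)) ℚ),
          MvPolynomial.aeval (Sum.elim y (cexp ∘ y)) (MvPolynomial.bind₁ s H) =
            MvPolynomial.aeval (Sum.elim (evOf y) (Sum.elim (π y) (cexp ∘ π y))) H := by
        intro y H
        have hfun : (fun i => MvPolynomial.aeval (Sum.elim y (cexp ∘ y)) (s i)) =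
            Sum.elim (evOf y) (Sum.elim (π y) (cexp ∘ π y)) := by
          funext i
          rcases i with i | (i | i)
          · simp [hs, hevOf]
          · fin_cases i <;> simp [hs, hπ]
          · fin_cases i <;> simp [hs, hπ]
        rw [MvPolynomial.aeval_bind₁, hfun]
      refine hWmem _ fun H hH => ?_
      have h0 : MvPolynomial.aeval (Sum.elim x (cexp ∘ x)) (MvPolynomial.bind₁ s H) = 0 := by
        rw [key]; exact hH
      have h1 := (hxm j).2 _ h0
      rw [key, hevm j] at h1
      exact h1
  -- ### (2) the family `Q` meets every exponential fibre finitely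
  have hQfib : ∀ ω : Fin 2 → ℂ, Set.Finite {p : Fin 2 → ℂ | p ∈ Q ∧ cexp ∘ p = ω} := by
    intro ω
    set y : Fin (m + 1) → ℂ := Fin.lastCases (ω 1) (fun k => cexp (x (Fin.castSucc k))) with hy
    have hfin := ((locusMates_cexp_fibre_finite hx y).preimage (f := xm) hxminj.injOn).image q
    refine hfin.subset ?_
    rintro _ ⟨⟨j, rfl⟩, hω⟩
    refine ⟨j, ⟨hxm j, funext fun i => ?_⟩, rfl⟩
    refine Fin.lastCases ?_ (fun k => ?_) i
    · have := congrFun hω 1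
      simp only [Function.comp_apply, hq1] at this
      simp only [Function.comp_apply, hy, Fin.lastCases_last, this]
    · simp only [Function.comp_apply, hy, Fin.lastCases_castSucc, hxmc]
      have h1 : cexp ((j : ℂ) * (μ k : ℂ) * (2 * ↑Real.pi * I)) = 1 := by
        have h := Complex.exp_int_mul_two_pi_mul_I (j * μ k)
        push_cast at h; exact h
      rw [Complex.exp_add, show 2 * ↑Real.pi * I * ((j : ℂ) * (μ k : ℂ)) = (j : ℂ) * (μ k : ℂ) * (2 * ↑Real.pi * I) by
        ring, h1, mul_one]
  -- ### (3) branches at infinity over the coset `v + 2πiℤ`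
  obtain ⟨e, R, r, B, X, he, hr, hXfin, hB, hrep⟩ := stub_cosetBranchCover W hWcl hWdim v
  have hbr : ∀ b ∈ B, ∃ L : ℕ, ∀ G : Finset ℤ, L ≤ G.card →
      Set.Finite {k : ℤ | ∀ j ∈ G, ∃ p ∈ Q, ∃ t : ℂ,
        t = (p 0) ^ (-((e : ℂ)⁻¹)) ∧ p 0 = v + 2 * ↑Real.pi * I * ((k + j : ℤ) : ℂ) ∧
        0 < ‖t‖ ∧ ‖t‖ < r ∧ Sum.elim p (cexp ∘ p) = 𝔟[e, b.2.2.2, b.1, b.2.1, b.2.2.1, t]} := by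
    intro b hb
    obtain ⟨hban, hbW⟩ := hB b hb
    exact branch_window_finite_of_fibre hWdim he hr hban hbW v hQW hQfib
  choose! Lb hLb using hbr
  set L : ℕ := B.sup Lb with hL
  set N : ℕ := B.card * L + 1 with hN
  -- all but finitely many `j` are covered
  obtain ⟨J₀, hJ₀⟩ : ∃ J₀ : ℤ, ∀ j : ℤ, J₀ ≤ j → R < ‖q j 0‖ ∧ q j ∉ X := by
    have hf1 : Set.Finite {j : ℤ | ‖v + 2 * ↑Real.pi * I * ((j * d : ℤ) : ℂ)‖ ≤ R} :=
      (finite_int_norm_coset_le v R).preimage (f := fun j : ℤ => j * d) (mul_left_injective₀ hk₀).injOn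
    have hf2 : Set.Finite (q ⁻¹' X) := hXfin.preimage hqinj.injOn
    obtain ⟨M, hM⟩ := (hf1.union hf2).bddAbove
    refine ⟨M + 1, fun j hj => ?_⟩
    have hjn : j ∉ {j : ℤ | ‖v + 2 * ↑Real.pi * I * ((j * d : ℤ) : ℂ)‖ ≤ R} ∪ q ⁻¹' X := fun h => by
      have := hM h; omega
    rw [Set.mem_union, not_or] at hjn
    refine ⟨?_, hjn.2⟩
    rw [hq0]; exact lt_of_not_ge hjn.1
  have hpos : ∀ j : ℤ, J₀ ≤ j → ∃ b ∈ B, 0 < ‖(q j 0) ^ (-((e : ℂ)⁻¹))‖ ∧ ‖(q j 0) ^ (-((e : ℂ)⁻¹))‖ < r ∧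
      Sum.elim (q j) (cexp ∘ q j) = 𝔟[e, b.2.2.2, b.1, b.2.1, b.2.2.1, (q j 0) ^ (-((e : ℂ)⁻¹))] := by
    intro j hj
    obtain ⟨hRj, hXj⟩ := hJ₀ j hj
    exact hrep (q j) (hQW ⟨j, rfl⟩) ⟨j * d, hq0 j⟩ hRj hXj
  choose! σ hσB hσ using hpos
  -- first pigeonhole: a popular branch in each block of `N` consecutive positions
  have hblock : ∀ a : ℕ, ∃ b ∈ B, ∃ T ∈ (Finset.range N).powerset, L < T.card ∧
      ∀ i ∈ T, σ (J₀ + ((a * N + i : ℕ) : ℤ)) = b := by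
    intro a
    obtain ⟨b, hb, hlt⟩ := Finset.exists_lt_card_fiber_of_mul_lt_card_of_maps_to (s := Finset.range N) (t := B)
      (f := fun i : ℕ => σ (J₀ + ((a * N + i : ℕ) : ℤ))) (n := L)
      (fun i _ => hσB _ (by omega)) (by rw [Finset.card_range, hN]; omega)
    exact ⟨b, hb, _, Finset.mem_powerset.2 (Finset.filter_subset _ _), hlt, fun i hi => (Finset.mem_filter.1 hi).2⟩
  choose bA hbA TA hTA hLT hσT using hblock
  -- second pigeonhole: a popular (branch, pattern) among the blocks
  obtain ⟨⟨⟨b, hb⟩, ⟨T, hT⟩⟩, hinf0⟩ := Finite.exists_infinite_fiber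
    (fun a : ℕ => ((⟨bA a, hbA a⟩ : B), (⟨TA a, hTA a⟩ : (Finset.range N).powerset)))
  have hinf := Set.infinite_coe_iff.1 hinf0
  have hA : ∀ a : ℕ, a ∈ (fun a : ℕ => ((⟨bA a, hbA a⟩ : B), (⟨TA a, hTA a⟩ : (Finset.range N).powerset))) ⁻¹'
      {((⟨b, hb⟩ : B), (⟨T, hT⟩ : (Finset.range N).powerset))} → bA a = b ∧ TA a = T := by
    intro a ha
    simp only [Set.mem_preimage, Set.mem_singleton_iff, Prod.mk.injEq, Subtype.mk.injEq] at ha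
    exact ha
  -- the fixed window and its infinitely many positions on the branch `b`
  set G : Finset ℤ := T.image (fun i : ℕ => (i : ℤ) * d) with hG
  have hGcard : G.card = T.card := Finset.card_image_of_injective _ fun i i' h => by
    have := mul_right_cancel₀ hk₀ h; exact_mod_cast this
  obtain ⟨a₀, ha₀⟩ := hinf.nonempty
  have hLG : Lb b ≤ G.card := by
    rw [hGcard, ← (hA a₀ ha₀).2]
    exact ((Finset.le_sup hb).trans_lt (hLT a₀)).le
  have hfin := hLb b hb G hLG
  refine (Set.Infinite.image (f := fun a : ℕ => (J₀ + ((a * N : ℕ) : ℤ)) * d) (fun a _ a' _ h => ?_) hinf).not_finite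
    (hfin.subset ?_)
  · have h1 : (J₀ + ((a * N : ℕ) : ℤ)) = J₀ + ((a' * N : ℕ) : ℤ) := mul_right_cancel₀ hk₀ h
    have h2 : a * N = a' * N := by omega
    exact Nat.eq_of_mul_eq_mul_right (by rw [hN]; omega) h2
  · rintro _ ⟨a, ha, rfl⟩
    obtain ⟨hba, hTa⟩ := hA a ha
    intro g hg
    obtain ⟨i, hi, rfl⟩ := Finset.mem_image.1 hg
    have hj : J₀ ≤ J₀ + ((a * N + i : ℕ) : ℤ) := by omega
    obtain ⟨ht0, htr, hrepr⟩ := hσ _ hj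
    rw [← hTa] at hi
    rw [hσT a i hi, hba] at hrepr
    refine ⟨q (J₀ + ((a * N + i : ℕ) : ℤ)), ⟨_, rfl⟩, _, rfl, ?_, ht0, htr, hrepr⟩
    rw [hq0]; push_cast; ring

end Summit.Schanuel.Schanuel.Cruxes.MinimalCounterexampleInAcl.KernelArithmeticSelection

end
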